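import Summits.HubbardSuperconductivity.HubbardSuperconductivity.Theorems.RvbParentAnchorEndpointTransfer

/-!
# Crux `PathLRO` (stmt-HubbardSuperconductivity-2654, route `RvbParentAnchor`) — strategist pass r1:
# the ACCUMULATION LEMMA and the typed candidate decompositions of the STRATEGY CENSUS

Companion file of `Cruxes/PathLRO/STRATEGY-CENSUS.md` (seat
`planner-cstrat-stmt-HubbardSuperconductivity-2654-r1-0`, 2026-08-17). Kernel-checked content:

* §1 `endpoint_core_acc_exists` — the finite-dimensional endpoint transfer of the landed
  `Theorems.RvbParentAnchor.endpoint_core` with two changes: the order floor is assumed only on an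
  ARBITRARY coupling set `S ⊆ ℝ` accumulating at `0⁺`, and NO simplicity is assumed; conclusion:
  SOME normalised sector ground state of the unperturbed `H` inherits the floor.
* §2 torus level: `exists_groundState_floor_of_floorOn` (every piece that keeps the d-wave floor of
  the penalised family `hubbardTorus 2 L 1 U + s • P L` on a coupling set accumulating at `0⁺`
  yields, at that side, a Hubbard sector ground state with the floor — the ∃-ground-state content of
  the summit at `(U, δ)`), `summitAt_of_floorOn_of_simple` (with simplicity: the summit matrix at
  `(U, δ)`), `summit_iff_exists_summitAt`.
* §3 the quantifier skeleton of `PathLRO` as named predicates (`AnchorSpec`, `PathBlock`,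
  `pathLRO_iff`, `anchorExists_iff`) and, per seam of the census, the typed pieces with their
  assemblies and the checked reason each division fails the REDIRECT certificate:
  D1 `ContinuationLaw` (assembly = modus ponens under `∃`; the law yields the summit at EVERY doping
  carrying an anchor), D2 `SmallCouplingFloor s₀` (⇒ summit at `(U,δ)`), D3 `PathOrderOnly`
  (⇒ ∃-ground-state d-wave order at `(U,δ)`), D8 (pinned datum: the path piece is `EndpointTransfer`'s
  hypothesis verbatim ⇒ summit).

No `sorry`. Nothing here is a route item; nothing is proposed to `Theorems/`.
-/

set_option linter.dupNamespace false
set_option linter.unusedVariables false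

noncomputable section

namespace Summit.HubbardSuperconductivity.HubbardSuperconductivity.Cruxes.PathLRO.StrategistR1

open Matrix Filter Topology Literature.MathematicalPhysics.QuantumLattice Literature.Probability.LatticeModels
open Literature.MathematicalPhysics.QuantumLattice.EigenvalueContinuation
  (isCompact_unitSphere_inter continuous_energy)
open Summit.HubbardSuperconductivity.HubbardSuperconductivity.Theses.RvbParentAnchor
open Summit.HubbardSuperconductivity.HubbardSuperconductivity.Theorems.RvbParentAnchor
  (re_energy_smul re_norm_smul apply_eq_zero_of_mapsTo endpointTransfer_proof)
open Summit.HubbardSuperconductivity.TwTipContinuation.Negative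
  (lroTerm_eq expect_pairIntensity_le side_pow_pos)

/-! ## §1 The accumulation lemma (finite-dimensional core, no simplicity) -/

section Core

variable {ι : Type*} [Fintype ι]

/-- **Endpoint transfer on an accumulating coupling set, ∃-form.** `H` Hermitian-in-use with a
normalised sector ground state `ψ ∈ K`; `S ⊆ ℝ` any set of couplings accumulating at `0⁺`; for
`s ∈ S` the perturbed matrix `H + sP` has a normalised sector ground state obeying the variational
principle on `K`, and every such ground state has `c ≤ Re⟨v, D v⟩`. Then SOME normalised sector
ground state `w` of `H` has `c ≤ Re⟨w, D w⟩`. (The landed `endpoint_core` is the case `S = (0,∞)`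
followed by simplicity.) Kato (1966) II §5. [folklore] -/
theorem endpoint_core_acc_exists (H P D : Matrix ι ι ℂ) (K : Submodule ℂ (ι → ℂ)) (S : Set ℝ)
    (hS : ∀ ε : ℝ, 0 < ε → ∃ s ∈ S, 0 < s ∧ s < ε)
    (ψ : ι → ℂ) (hψK : ψ ∈ K) (hψ1 : star ψ ⬝ᵥ ψ = 1)
    (hHψ : H *ᵥ ψ = ((H.minEnergyOn K : ℝ) : ℂ) • ψ)
    (hvar : ∀ v ∈ K, star v ⬝ᵥ v = 1 → H.minEnergyOn K ≤ (star v ⬝ᵥ H *ᵥ v).re)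
    (hGS : ∀ s ∈ S, ∃ v ∈ K, star v ⬝ᵥ v = 1 ∧
      (H + (s : ℂ) • P) *ᵥ v = (((H + (s : ℂ) • P).minEnergyOn K : ℝ) : ℂ) • v)
    (hvarS : ∀ s ∈ S, ∀ v ∈ K, star v ⬝ᵥ v = 1 →
      (H + (s : ℂ) • P).minEnergyOn K ≤ (star v ⬝ᵥ (H + (s : ℂ) • P) *ᵥ v).re)
    {c : ℝ} (hfloor : ∀ s ∈ S, ∀ v ∈ K, star v ⬝ᵥ v = 1 →
      (H + (s : ℂ) • P) *ᵥ v = (((H + (s : ℂ) • P).minEnergyOn K : ℝ) : ℂ) • v →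
        c ≤ (star v ⬝ᵥ D *ᵥ v).re) :
    ∃ w ∈ K, star w ⬝ᵥ w = 1 ∧ H *ᵥ w = ((H.minEnergyOn K : ℝ) : ℂ) • w ∧
      c ≤ (star w ⬝ᵥ D *ᵥ w).re := by
  classical
  set m : ℝ := H.minEnergyOn K with hm
  -- the compact unit sphere of `K`
  set C : Set (ι → ℂ) := {u | u ∈ K ∧ star u ⬝ᵥ u = 1} with hC
  have hCc : IsCompact C := isCompact_unitSphere_inter K
  have hψC : ψ ∈ C := ⟨hψK, hψ1⟩
  -- bounds for `Re⟨u, P u⟩` on `C`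
  obtain ⟨uhi, -, hhi⟩ := hCc.exists_isMaxOn ⟨ψ, hψC⟩ (continuous_energy P).continuousOn
  obtain ⟨ulo, -, hlo⟩ := hCc.exists_isMinOn ⟨ψ, hψC⟩ (continuous_energy P).continuousOn
  set Bhi : ℝ := (star uhi ⬝ᵥ P *ᵥ uhi).re
  set Blo : ℝ := (star ulo ⬝ᵥ P *ᵥ ulo).re
  -- admissible couplings `sq k ∈ S` with `0 < sq k < 1/(k+1)`
  have hk : ∀ k : ℕ, ∃ s ∈ S, 0 < s ∧ s < 1 / ((k : ℝ) + 1) := fun k => hS _ (by positivity)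
  choose sq hsqS hsq_pos hsq_lt using hk
  have hsq0 : Tendsto sq atTop (𝓝 0) :=
    squeeze_zero (fun k => (hsq_pos k).le) (fun k => (hsq_lt k).le)
      tendsto_one_div_add_atTop_nhds_zero_nat
  choose v hvK hv1 hveig using fun k => hGS (sq k) (hsqS k)
  set E : ℕ → ℝ := fun k => (H + ((sq k : ℝ) : ℂ) • P).minEnergyOn K with hE
  -- energy identities
  have hsplit : ∀ (s : ℝ) (u : ι → ℂ), (star u ⬝ᵥ (H + (s : ℂ) • P) *ᵥ u).re =
      (star u ⬝ᵥ H *ᵥ u).re + s * (star u ⬝ᵥ P *ᵥ u).re := by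
    intro s u
    rw [add_mulVec, dotProduct_add, Complex.add_re, smul_mulVec, dotProduct_smul,
      smul_eq_mul, Complex.re_ofReal_mul]
  have hEψ : (star ψ ⬝ᵥ H *ᵥ ψ).re = m := by
    rw [hHψ, dotProduct_smul, hψ1, smul_eq_mul, mul_one, Complex.ofReal_re]
  have hEv : ∀ k, (star (v k) ⬝ᵥ (H + ((sq k : ℝ) : ℂ) • P) *ᵥ v k).re = E k := by
    intro k
    rw [hveig, dotProduct_smul, hv1, smul_eq_mul, mul_one, Complex.ofReal_re]
  -- squeeze: `sq k * Blo ≤ E k - m ≤ sq k * Bhi`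
  have hup : ∀ k, E k - m ≤ sq k * Bhi := by
    intro k
    have h1 := hvarS (sq k) (hsqS k) ψ hψK hψ1
    rw [hsplit, hEψ] at h1
    have h2 : (star ψ ⬝ᵥ P *ᵥ ψ).re ≤ Bhi := hhi hψC
    nlinarith [hsq_pos k]
  have hdown : ∀ k, sq k * Blo ≤ E k - m := by
    intro k
    have h1 := hvar (v k) (hvK k) (hv1 k)
    have h3 := hEv k
    rw [hsplit] at h3
    have h2 : Blo ≤ (star (v k) ⬝ᵥ P *ᵥ v k).re := hlo ⟨hvK k, hv1 k⟩
    nlinarith [hsq_pos k]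
  have hEm : Tendsto E atTop (𝓝 m) := by
    have hsub : Tendsto (fun k => E k - m) atTop (𝓝 0) := by
      refine tendsto_of_tendsto_of_tendsto_of_le_of_le (f := fun k => E k - m) ?_ ?_ hdown hup
      · simpa using hsq0.mul_const Blo
      · simpa using hsq0.mul_const Bhi
    have := hsub.add_const m
    simpa using this
  -- a convergent subsequence on the compact unit sphere
  obtain ⟨w, hwC, φ, hφ, hconv⟩ := tendsto_subseq_of_bounded hCc.isBounded (x := v)
    fun k => (⟨hvK k, hv1 k⟩ : v k ∈ C)
  rw [hCc.isClosed.closure_eq] at hwC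
  obtain ⟨hwK, hw1⟩ := hwC
  -- the limit is a sector ground state of `H`
  have hmul : ∀ A : Matrix ι ι ℂ, Tendsto (fun k => A *ᵥ v (φ k)) atTop (𝓝 (A *ᵥ w)) := by
    intro A
    have hc : Continuous fun u : ι → ℂ => A *ᵥ u :=
      (Matrix.mulVecLin A).continuous_of_finiteDimensional
    exact (hc.tendsto w).comp hconv
  have hHw : H *ᵥ w = (m : ℂ) • w := by
    have h1 : ∀ k, H *ᵥ v (φ k) =
        ((E (φ k) : ℝ) : ℂ) • v (φ k) - ((sq (φ k) : ℝ) : ℂ) • (P *ᵥ v (φ k)) := by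
      intro k
      have h := hveig (φ k)
      rw [add_mulVec, smul_mulVec] at h
      exact eq_sub_of_add_eq h
    have h2 : Tendsto (fun k => ((E (φ k) : ℝ) : ℂ) • v (φ k) -
        ((sq (φ k) : ℝ) : ℂ) • (P *ᵥ v (φ k))) atTop (𝓝 ((m : ℂ) • w - (0 : ℂ) • (P *ᵥ w))) := by
      refine Tendsto.sub (Tendsto.smul ?_ hconv) (Tendsto.smul ?_ (hmul P))
      · exact (Complex.continuous_ofReal.tendsto m).comp (hEm.comp hφ.tendsto_atTop)
      · exact (Complex.continuous_ofReal.tendsto 0).comp (hsq0.comp hφ.tendsto_atTop)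
    rw [zero_smul, sub_zero] at h2
    exact tendsto_nhds_unique ((hmul H).congr h1) h2
  -- the floor passes to the limit
  have hfl : c ≤ (star w ⬝ᵥ D *ᵥ w).re := by
    refine ge_of_tendsto (((continuous_energy D).tendsto w).comp hconv)
      (Eventually.of_forall fun k => ?_)
    exact hfloor (sq (φ k)) (hsqS _) (v (φ k)) (hvK _) (hv1 _) (hveig _)
  exact ⟨w, hwK, hw1, hHw, hfl⟩

/-- The positive half-line accumulates at `0⁺`. [folklore] -/
theorem acc_Ioi : ∀ ε : ℝ, 0 < ε → ∃ s ∈ Set.Ioi (0 : ℝ), 0 < s ∧ s < ε :=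
  fun ε hε => ⟨ε / 2, half_pos hε, half_pos hε, half_lt_self hε⟩

/-- Every interval `(0, s₀]`, `s₀ > 0`, accumulates at `0⁺`. [folklore] -/
theorem acc_Ioc {s₀ : ℝ} (hs₀ : 0 < s₀) :
    ∀ ε : ℝ, 0 < ε → ∃ s ∈ Set.Ioc (0 : ℝ) s₀, 0 < s ∧ s < ε := by
  intro ε hε
  refine ⟨min (ε / 2) s₀, ⟨lt_min (half_pos hε) hs₀, min_le_right _ _⟩,
    lt_min (half_pos hε) hs₀, lt_of_le_of_lt (min_le_left _ _) (half_lt_self hε)⟩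

end Core

/-! ## §2 Torus level: pieces keeping the floor near `s = 0⁺` are the summit at `(U, δ)` -/

/-- Operators on the Fock space of the `L × L` torus. -/
local notation "Op[" L "]" =>
  Matrix (Finset (Orb (FermionTorus 2 L))) (Finset (Orb (FermionTorus 2 L))) ℂ

/-- `N_L(δ) = 2⌊(1-δ)L²/2⌋` (parse-time abbreviation: the elaborated term is verbatim the route's). -/
local notation "Nₑ[" δ "," L "]" => (2 * ⌊(1 - (δ : ℝ)) * ((L : ℕ) : ℝ) ^ 2 / 2⌋₊)

/-- `Re⟨ψ, Δ_dᴴ Δ_d ψ⟩` (parse-time abbreviation). -/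
local notation "dInt[" L "," ψ "]" =>
  Complex.re (expect ((pairField dWaveFormFactor L)ᴴ * pairField dWaveFormFactor L) ψ)

/-- The summit's matrix at `(U, δ)` (verbatim body of `Literature.Hubbard.DWaveSuperconductivityHubbard`). -/
def SummitAt (U δ : ℝ) : Prop :=
  ∀ (N : ℕ → ℕ) (ψ : ∀ L, Fock (Orb (FermionTorus 2 L))),
    (∀ L, Even L → N L = Nₑ[δ, L] ∧ star (ψ L) ⬝ᵥ ψ L = 1 ∧
        IsGroundStateInSector (hubbardTorus 2 L 1 U) (N L) 0 (ψ L)) →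
      HasLongRangeOrder (fun k => halfOpenBox 2 (2 * k))
        (fun k => torusPullback (pairFieldCorr dWaveFormFactor ψ) (2 * k))

/-- The summit is `∃ U > 0, ∃ δ ∈ (0, 1/2), SummitAt U δ` — by `Iff.rfl`. [folklore] -/
theorem summit_iff_exists_summitAt :
    _root_.HubbardSuperconductivity ↔ ∃ U : ℝ, 0 < U ∧ ∃ δ ∈ Set.Ioo (0 : ℝ) (1 / 2), SummitAt U δ :=
  Iff.rfl

/-- The ∃-ground-state form of d-wave order at `(U, δ)` along large even sides: SOME normalised
sector ground state of the pure Hubbard torus carries the floor `c' L⁴`. -/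
def ExistsGSOrderAt (U δ c' : ℝ) (L₁ : ℕ) : Prop :=
  ∀ (L : ℕ) [NeZero L], Even L → L₁ ≤ L →
    ∃ w, IsGroundStateInSector (hubbardTorus 2 L 1 U) Nₑ[δ, L] 0 w ∧ star w ⬝ᵥ w = 1 ∧
      c' * (L : ℝ) ^ 4 ≤ dInt[L, w]

/-- d-wave floor `c' L⁴` for every normalised sector ground state of the penalised family
`hubbardTorus 2 L 1 U + s • P L`, for the couplings `s ∈ S` only. -/
def FloorOn (S : Set ℝ) (δ : ℝ) (P : (L : ℕ) → Op[L]) (U c' : ℝ) (L : ℕ) [NeZero L] : Prop :=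
  ∀ s ∈ S, ∀ ψ, IsGroundStateInSector (hubbardTorus 2 L 1 U + (s : ℂ) • P L) Nₑ[δ, L] 0 ψ →
    star ψ ⬝ᵥ ψ = 1 → c' * (L : ℝ) ^ 4 ≤ dInt[L, ψ]

/-- Simplicity of the Hubbard `(N_L, 0)`-sector ground state at side `L` (verbatim clause of `PathLRO`). -/
def SimpleGS (δ U : ℝ) (L : ℕ) [NeZero L] : Prop :=
  ∀ ψ₁ ψ₂, IsGroundStateInSector (hubbardTorus 2 L 1 U) Nₑ[δ, L] 0 ψ₁ →
    IsGroundStateInSector (hubbardTorus 2 L 1 U) Nₑ[δ, L] 0 ψ₂ → ∃ a : ℂ, ψ₂ = a • ψ₁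

/-- **Torus form of the accumulation lemma (no simplicity).** If `P L` is Hermitian and preserves the
sector, and the penalised family keeps the d-wave floor on a coupling set `S` accumulating at `0⁺`,
then SOME normalised Hubbard sector ground state at side `L` has the floor. [folklore] -/
theorem exists_groundState_floor_of_floorOn {U δ c' : ℝ} {P : (L : ℕ) → Op[L]} {S : Set ℝ}
    (hS : ∀ ε : ℝ, 0 < ε → ∃ s ∈ S, 0 < s ∧ s < ε) (hδ : -1 ≤ δ)
    (L : ℕ) [NeZero L] (hPh : (P L).IsHermitian)
    (hPmap : ∀ v, v ∈ szSector (Λ := FermionTorus 2 L) Nₑ[δ, L] 0 →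
      P L *ᵥ v ∈ szSector (Λ := FermionTorus 2 L) Nₑ[δ, L] 0)
    (hfl : FloorOn S δ P U c' L) :
    ∃ w, IsGroundStateInSector (hubbardTorus 2 L 1 U) Nₑ[δ, L] 0 w ∧ star w ⬝ᵥ w = 1 ∧
      c' * (L : ℝ) ^ 4 ≤ dInt[L, w] := by
  classical
  unfold FloorOn at hfl
  set n : ℕ := ⌊(1 - δ) * (L : ℝ) ^ 2 / 2⌋₊ with hn
  set K := szSector (Λ := FermionTorus 2 L) (2 * n) 0 with hK
  set H := hubbardTorus 2 L 1 U with hH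
  have hHerm : H.IsHermitian :=
    hubbardTorus_isHermitian (hamiltonian_isHermitian_and_commute_holds _) 1 U
  have hKmem : ∀ v : Fock (Orb (FermionTorus 2 L)), v ∈ K ↔
      ∀ s, ¬((upPart s).card = n ∧ (downPart s).card = n) → v s = 0 :=
    fun v => mem_szSector_two_mul_zero_iff n v
  have hHinv : ∀ s s' : Finset (Orb (FermionTorus 2 L)),
      ¬((upPart s).card = n ∧ (downPart s).card = n) →
      ((upPart s').card = n ∧ (downPart s').card = n) → H s s' = 0 := by
    intro s s' hs hs'
    by_contra h
    have := LiebThm1.preservesSectors_hamiltonian (fermionTorusGraph 2 L) 1 U s s' h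
    exact hs ⟨this.1.trans hs'.1, this.2.trans hs'.2⟩
  have hPinv := apply_eq_zero_of_mapsTo (A := P L)
    (fun s : Finset (Orb (FermionTorus 2 L)) => (upPart s).card = n ∧ (downPart s).card = n)
    K hKmem hPmap
  have hn2 : n ≤ L ^ 2 := Literature.Barriers.HubbardSuperconductivity.natFloor_filling_le_sq hδ L
  have hp : ∃ s : Finset (Orb (FermionTorus 2 L)), (upPart s).card = n ∧ (downPart s).card = n := by
    have hcard : n ≤ Fintype.card (FermionTorus 2 L) := by
      rwa [Summit.HubbardSuperconductivity.NoGo.card_fermionTorus_two]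
    obtain ⟨α₀, -, hα₀⟩ : ∃ α₀ : Finset (FermionTorus 2 L), α₀ ⊆ Finset.univ ∧ α₀.card = n :=
      Finset.exists_subset_card_eq (by rwa [Finset.card_univ])
    exact ⟨pairSet α₀ α₀, by rw [upPart_pairSet, hα₀], by rw [downPart_pairSet, hα₀]⟩
  have hAS : ∀ s : ℝ, (H + (s : ℂ) • P L).IsHermitian := fun s =>
    hHerm.add (hPh.smul (by rw [isSelfAdjoint_iff, Complex.star_def, Complex.conj_ofReal]))
  -- a normalised sector ground state of `H` itself
  obtain ⟨⟨ψ₀, hψ₀K, hψ₀0, hHψ₀⟩, -⟩ := sector_groundState H hHerm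
    (fun t => (upPart t).card = n ∧ (downPart t).card = n) hp hHinv K hKmem
  obtain ⟨a₀, -, ha₀⟩ := exists_smul_unit hψ₀0
  have hHψ : H *ᵥ (a₀ • ψ₀) = ((H.minEnergyOn K : ℝ) : ℂ) • (a₀ • ψ₀) := by
    rw [mulVec_smul, hHψ₀, smul_comm]
  -- perturbed ground states and variational principles
  have hGS : ∀ s ∈ S, ∃ v ∈ K, star v ⬝ᵥ v = 1 ∧
      (H + (s : ℂ) • P L) *ᵥ v = (((H + (s : ℂ) • P L).minEnergyOn K : ℝ) : ℂ) • v := by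
    intro s _
    have hinv : ∀ t t' : Finset (Orb (FermionTorus 2 L)),
        ¬((upPart t).card = n ∧ (downPart t).card = n) →
        ((upPart t').card = n ∧ (downPart t').card = n) → (H + (s : ℂ) • P L) t t' = 0 := by
      intro t t' ht ht'
      rw [Matrix.add_apply, Matrix.smul_apply, hHinv t t' ht ht', hPinv t t' ht ht', smul_zero,
        add_zero]
    obtain ⟨⟨v, hvK, hv0, hAv⟩, -⟩ := sector_groundState (H + (s : ℂ) • P L) (hAS s)
      (fun t => (upPart t).card = n ∧ (downPart t).card = n) hp hinv K hKmem
    obtain ⟨a, -, ha1⟩ := exists_smul_unit hv0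
    refine ⟨a • v, K.smul_mem a hvK, ha1, ?_⟩
    rw [mulVec_smul, hAv, smul_comm]
  have hvar : ∀ v ∈ K, star v ⬝ᵥ v = 1 → H.minEnergyOn K ≤ (star v ⬝ᵥ H *ᵥ v).re :=
    fun v hv h1 => minEnergyOn_le_rayleigh_of_mem hHerm K hv h1
  have hvarS : ∀ s ∈ S, ∀ v ∈ K, star v ⬝ᵥ v = 1 →
      (H + (s : ℂ) • P L).minEnergyOn K ≤ (star v ⬝ᵥ (H + (s : ℂ) • P L) *ᵥ v).re :=
    fun s _ v hv h1 => minEnergyOn_le_rayleigh_of_mem (hAS s) K hv h1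
  have hfloor : ∀ s ∈ S, ∀ v ∈ K, star v ⬝ᵥ v = 1 →
      (H + (s : ℂ) • P L) *ᵥ v = (((H + (s : ℂ) • P L).minEnergyOn K : ℝ) : ℂ) • v →
        c' * (L : ℝ) ^ 4 ≤ (star v ⬝ᵥ ((pairField dWaveFormFactor L)ᴴ *
          pairField dWaveFormFactor L) *ᵥ v).re := by
    intro s hs v hvK hv1 hveig
    have hv0 : v ≠ 0 := by
      intro h; rw [h, dotProduct_zero] at hv1; exact zero_ne_one hv1
    exact hfl s hs v ⟨hvK, hv0, hveig⟩ hv1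
  obtain ⟨w, hwK, hw1, hHw, hflw⟩ := endpoint_core_acc_exists H (P L) _ K S hS (a₀ • ψ₀)
    (K.smul_mem a₀ hψ₀K) ha₀ hHψ hvar hGS hvarS hfloor
  have hw0 : w ≠ 0 := by
    intro h; rw [h, dotProduct_zero] at hw1; exact zero_ne_one hw1
  exact ⟨w, ⟨hwK, hw0, hHw⟩, hw1, hflw⟩

/-- **With simplicity, every ground state inherits the floor.** [folklore] -/
theorem floor_of_floorOn_of_simple {U δ c' : ℝ} {P : (L : ℕ) → Op[L]} {S : Set ℝ}
    (hS : ∀ ε : ℝ, 0 < ε → ∃ s ∈ S, 0 < s ∧ s < ε) (hδ : -1 ≤ δ)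
    (L : ℕ) [NeZero L] (hPh : (P L).IsHermitian)
    (hPmap : ∀ v, v ∈ szSector (Λ := FermionTorus 2 L) Nₑ[δ, L] 0 →
      P L *ᵥ v ∈ szSector (Λ := FermionTorus 2 L) Nₑ[δ, L] 0)
    (hfl : FloorOn S δ P U c' L) (hsimp : SimpleGS δ U L)
    (ψ : Fock (Orb (FermionTorus 2 L))) (hψ : IsGroundStateInSector (hubbardTorus 2 L 1 U) Nₑ[δ, L] 0 ψ)
    (hψ1 : star ψ ⬝ᵥ ψ = 1) : c' * (L : ℝ) ^ 4 ≤ dInt[L, ψ] := by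
  obtain ⟨w, hw, hw1, hflw⟩ := exists_groundState_floor_of_floorOn hS hδ L hPh hPmap hfl
  obtain ⟨a, ha⟩ := hsimp w ψ hw hψ
  have ha1 : ‖a‖ ^ 2 = 1 := by
    have h := re_norm_smul a w
    rw [← ha, hψ1, hw1, Complex.one_re, mul_one] at h
    exact h.symm
  change c' * (L : ℝ) ^ 4 ≤ (star ψ ⬝ᵥ ((pairField dWaveFormFactor L)ᴴ * pairField dWaveFormFactor L) *ᵥ ψ).re
  rw [ha, re_energy_smul, ha1, one_mul]
  exact hflw

/-- **Pieces keeping the floor near `0⁺` + simplicity = the summit at `(U, δ)`.** For every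
coupling set `S` accumulating at `0⁺`: admissibility of `P`, `FloorOn S` and `SimpleGS`, eventually
along even `L`, give `SummitAt U δ` (the landed `EndpointTransfer` is the case `S = (0, ∞)`).
[folklore] -/
theorem summitAt_of_floorOn_of_simple {U δ c' : ℝ} {P : (L : ℕ) → Op[L]} {S : Set ℝ}
    (hS : ∀ ε : ℝ, 0 < ε → ∃ s ∈ S, 0 < s ∧ s < ε) (hδ : -1 ≤ δ) (hc' : 0 < c')
    (h : ∃ L₁ : ℕ, ∀ (L : ℕ) [NeZero L], Even L → L₁ ≤ L →
      (P L).IsHermitian ∧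
      (∀ v, v ∈ szSector (Λ := FermionTorus 2 L) Nₑ[δ, L] 0 →
        P L *ᵥ v ∈ szSector (Λ := FermionTorus 2 L) Nₑ[δ, L] 0) ∧
      FloorOn S δ P U c' L ∧ SimpleGS δ U L) :
    SummitAt U δ := by
  classical
  intro N ψ hyp
  obtain ⟨L₁, hP⟩ := h
  have hfloorL : ∀ (L : ℕ) [NeZero L], Even L → L₁ ≤ L → c' * (L : ℝ) ^ 4 ≤ dInt[L, ψ L] := by
    intro L _ hE hL
    obtain ⟨hPh, hPmap, hfl, hsimp⟩ := hP L hE hL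
    obtain ⟨hN, hu, hgs⟩ := hyp L hE
    rw [hN] at hgs
    exact floor_of_floorOn_of_simple hS hδ L hPh hPmap hfl hsimp (ψ L) hgs hu
  -- the even-side `liminf` bookkeeping (verbatim from the landed `endpointTransfer_proof`)
  change 0 < liminf (fun k : ℕ => (∑ x ∈ halfOpenBox 2 (2 * k), ∑ y ∈ halfOpenBox 2 (2 * k),
          torusPullback (pairFieldCorr dWaveFormFactor ψ) (2 * k) x y) /
        ((halfOpenBox 2 (2 * k)).card : ℝ) ^ 2) atTop
  have hev : ∀ᶠ k in atTop, c' ≤ (∑ x ∈ halfOpenBox 2 (2 * k), ∑ y ∈ halfOpenBox 2 (2 * k),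
          torusPullback (pairFieldCorr dWaveFormFactor ψ) (2 * k) x y) /
        ((halfOpenBox 2 (2 * k)).card : ℝ) ^ 2 := by
    refine eventually_atTop.2 ⟨L₁ + 1, fun k hk => ?_⟩
    haveI : NeZero (2 * k) := ⟨by omega⟩
    rw [lroTerm_eq, le_div_iff₀ (side_pow_pos k)]
    exact hfloorL (2 * k) (even_two_mul k) (by omega)
  have hev' : ∀ᶠ k in atTop, (∑ x ∈ halfOpenBox 2 (2 * k), ∑ y ∈ halfOpenBox 2 (2 * k),
          torusPullback (pairFieldCorr dWaveFormFactor ψ) (2 * k) x y) /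
        ((halfOpenBox 2 (2 * k)).card : ℝ) ^ 2 ≤
      (∑ e ∈ insert 0 unitSteps, ‖((dWaveFormFactor e / Real.sqrt 2 : ℝ) : ℂ)‖ * 2) ^ 2 := by
    refine eventually_atTop.2 ⟨1, fun k hk => ?_⟩
    haveI : NeZero (2 * k) := ⟨by omega⟩
    obtain ⟨-, hu, -⟩ := hyp (2 * k) (even_two_mul k)
    rw [lroTerm_eq, div_le_iff₀ (side_pow_pos k)]
    exact expect_pairIntensity_le (2 * k) (ψ (2 * k)) hu
  exact lt_of_lt_of_le hc' (le_liminf_of_le (isCoboundedUnder_ge_of_eventually_le _ hev') hev)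


/-! ## §3 The quantifier skeleton of `PathLRO` and the candidate divisions of the census

`PathLRO = ∃ δ c r L₀ P, AnchorSpec δ c r L₀ P ∧ ∃ U c' L₁, PathBlock δ P U c' L₁` (`pathLRO_iff`,
`Iff.rfl`), `AnchorExists = ∃ δ c r L₀ P, AnchorSpec δ c r L₀ P` (`anchorExists_iff`),
`EndpointTransfer = ∀ U δ c' P, … → (∃ L₁, PathBlock δ P U c' L₁) → SummitAt U δ`
(`endpointTransfer_iff`). Skeleton of the path block:
`∃ U c' L₁ ∀^{even} L ≥ L₁ [Herm ∧ SectorPres ∧ (∀ s > 0 ∀ ψ ∈ GS_L(H_U + sP_L) floor c'L⁴) ∧ Simple_L(U,δ)]`.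
-/

/-- ANCHOR block of `PathLRO` as a predicate of its witnesses (verbatim; it is the body of
`AnchorExists` below its binders `δ, c, r, L₀, P`). -/
def AnchorSpec (δ c : ℝ) (r L₀ : ℕ) (P : (L : ℕ) → Op[L]) : Prop :=
  ∃ γ : ℕ → ℝ, Tendsto γ atTop (𝓝 0) ∧ ∀ (L : ℕ) [NeZero L], Even L → L₀ ≤ L →
    (P L).IsHermitian ∧
    (∃ Φ : TorusSite 2 L → _, P L = ∑ x, Φ x ∧ ∀ x, (Φ x).IsHermitian ∧
      (∀ v, 0 ≤ (star v ⬝ᵥ (Φ x *ᵥ v)).re ∧ (star v ⬝ᵥ (Φ x *ᵥ v)).re ≤ (star v ⬝ᵥ v).re) ∧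
      Φ x ∈ carEvenSubalgebra ((torusBall x r ×ˢ Finset.univ).image
        fun p => orb (FermionTorus.ofTorusSite p.1) p.2)) ∧
    (∀ v, v ∈ szSector Nₑ[δ, L] 0 → P L *ᵥ v ∈ szSector Nₑ[δ, L] 0) ∧
    (∃ v, v ∈ szSector Nₑ[δ, L] 0 ∧ v ≠ 0 ∧ P L *ᵥ v = 0) ∧
    (∀ ψ, IsGroundStateInSector (P L) Nₑ[δ, L] 0 ψ → star ψ ⬝ᵥ ψ = 1 →
      c * (L : ℝ) ^ 4 ≤ dInt[L, ψ] ∧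
      Complex.re (expect ((pairField sWave L)ᴴ * pairField sWave L) ψ) ≤ γ L * (L : ℝ) ^ 4 ∧
      Complex.re (expect ((pairField extendedSWave L)ᴴ * pairField extendedSWave L) ψ) ≤
        γ L * (L : ℝ) ^ 4)

/-- PATH block of `PathLRO` as a predicate of `(δ, P, U, c', L₁)` (verbatim). -/
def PathBlock (δ : ℝ) (P : (L : ℕ) → Op[L]) (U c' : ℝ) (L₁ : ℕ) : Prop :=
  ∀ (L : ℕ) [NeZero L], Even L → L₁ ≤ L →
    (P L).IsHermitian ∧
    (∀ v, v ∈ szSector Nₑ[δ, L] 0 → P L *ᵥ v ∈ szSector Nₑ[δ, L] 0) ∧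
    (∀ s : ℝ, 0 < s → ∀ ψ, IsGroundStateInSector (hubbardTorus 2 L 1 U + (s : ℂ) • P L) Nₑ[δ, L] 0 ψ →
      star ψ ⬝ᵥ ψ = 1 → c' * (L : ℝ) ^ 4 ≤ dInt[L, ψ]) ∧
    (∀ ψ₁ ψ₂, IsGroundStateInSector (hubbardTorus 2 L 1 U) Nₑ[δ, L] 0 ψ₁ →
      IsGroundStateInSector (hubbardTorus 2 L 1 U) Nₑ[δ, L] 0 ψ₂ → ∃ a : ℂ, ψ₂ = a • ψ₁)

/-- `PathLRO` is `∃ witnesses, AnchorSpec ∧ ∃ U c' L₁, PathBlock` — `Iff.rfl`. [folklore] -/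
theorem pathLRO_iff :
    PathLRO ↔ ∃ δ ∈ Set.Ioo (0 : ℝ) (1 / 2), ∃ c : ℝ, 0 < c ∧ ∃ r L₀ : ℕ,
      ∃ P : (L : ℕ) → Op[L], AnchorSpec δ c r L₀ P ∧
        ∃ U : ℝ, 0 < U ∧ ∃ c' : ℝ, 0 < c' ∧ ∃ L₁ : ℕ, PathBlock δ P U c' L₁ :=
  Iff.rfl

/-- `AnchorExists` is `∃ witnesses, AnchorSpec` — `Iff.rfl`. [folklore] -/
theorem anchorExists_iff :
    AnchorExists ↔ ∃ δ ∈ Set.Ioo (0 : ℝ) (1 / 2), ∃ c : ℝ, 0 < c ∧ ∃ r L₀ : ℕ,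
      ∃ P : (L : ℕ) → Op[L], AnchorSpec δ c r L₀ P :=
  Iff.rfl

/-- `EndpointTransfer` consumes exactly a path block — `Iff.rfl`. [folklore] -/
theorem endpointTransfer_iff :
    EndpointTransfer ↔ ∀ (U δ c' : ℝ) (P : (L : ℕ) → Op[L]), 0 < U → δ ∈ Set.Ioo (0 : ℝ) (1 / 2) →
      0 < c' → (∃ L₁ : ℕ, PathBlock δ P U c' L₁) → SummitAt U δ :=
  Iff.rfl

/-- The path block is admissibility ∧ `FloorOn (0,∞)` ∧ simplicity, side by side. [folklore] -/
theorem pathBlock_iff_floorOn (δ : ℝ) (P : (L : ℕ) → Op[L]) (U c' : ℝ) (L₁ : ℕ) :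
    PathBlock δ P U c' L₁ ↔ ∀ (L : ℕ) [NeZero L], Even L → L₁ ≤ L →
      (P L).IsHermitian ∧
      (∀ v, v ∈ szSector Nₑ[δ, L] 0 → P L *ᵥ v ∈ szSector Nₑ[δ, L] 0) ∧
      FloorOn (Set.Ioi 0) δ P U c' L ∧ SimpleGS δ U L :=
  Iff.rfl

/-! ### D8 (σ-witness seam: pin the datum) — the path piece is `EndpointTransfer`'s hypothesis -/

/-- At ANY datum the path piece alone is the summit matrix at `(U, δ)` (landed
`endpointTransfer_proof`, one line): pinning the witnesses separates the blocks into closed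
statements but leaves the whole of `S` inside the path piece. [folklore] -/
theorem d8_pathBlock_summitAt {U δ c' : ℝ} {P : (L : ℕ) → Op[L]} {L₁ : ℕ} (hU : 0 < U)
    (hδ : δ ∈ Set.Ioo (0 : ℝ) (1 / 2)) (hc' : 0 < c') (h : PathBlock δ P U c' L₁) : SummitAt U δ :=
  endpointTransfer_proof U δ c' P hU hδ hc' ⟨L₁, h⟩

/-- D8 assembly (anchor piece ∧ path piece at the pinned datum ⇒ `PathLRO`): an anonymous
constructor — the trivial seam. [folklore] -/
theorem d8_assembly {δ c U c' : ℝ} {r L₀ L₁ : ℕ} {P : (L : ℕ) → Op[L]}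
    (hδ : δ ∈ Set.Ioo (0 : ℝ) (1 / 2)) (hc : 0 < c) (hA : AnchorSpec δ c r L₀ P) (hU : 0 < U)
    (hc' : 0 < c') (hP : PathBlock δ P U c' L₁) : PathLRO :=
  ⟨δ, hδ, c, hc, r, L₀, P, hA, U, hU, c', hc', L₁, hP⟩

/-! ### D1 (σ-hyp seam: anchor ∃ / continuation ∀) -/

/-- D1 piece 2: the CONTINUATION AS A LAW over all anchors (the only closed form of the continuation
that can meet the anchor's existential without pinning `P`). -/
def ContinuationLaw : Prop :=
  ∀ δ ∈ Set.Ioo (0 : ℝ) (1 / 2), ∀ c : ℝ, 0 < c → ∀ (r L₀ : ℕ) (P : (L : ℕ) → Op[L]),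
    AnchorSpec δ c r L₀ P → ∃ U : ℝ, 0 < U ∧ ∃ c' : ℝ, 0 < c' ∧ ∃ L₁ : ℕ, PathBlock δ P U c' L₁

/-- D1 assembly: modus ponens under the anchor's existential (the seam is two lines). [folklore] -/
theorem d1_assembly (hA : AnchorExists) (hC : ContinuationLaw) : PathLRO := by
  obtain ⟨δ, hδ, c, hc, r, L₀, P, hspec⟩ := hA
  exact ⟨δ, hδ, c, hc, r, L₀, P, hspec, hC δ hδ c hc r L₀ P hspec⟩

/-- D1's law is summit-or-harder: at EVERY doping carrying an anchor it yields the summit matrix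
for some `U > 0` (and anchors as typed exist at every `δ ∈ (0,1/2)`: the refuter's frozen
dimer-covering witness, evidence `AnchorExistsJunkWitness.md` on stmt-2655). [folklore] -/
theorem d1_law_summitAt_at_every_anchored_doping (hC : ContinuationLaw) {δ : ℝ}
    (hδ : δ ∈ Set.Ioo (0 : ℝ) (1 / 2))
    (hanchor : ∃ c : ℝ, 0 < c ∧ ∃ (r L₀ : ℕ) (P : (L : ℕ) → Op[L]), AnchorSpec δ c r L₀ P) :
    ∃ U : ℝ, 0 < U ∧ SummitAt U δ := by
  obtain ⟨c, hc, r, L₀, P, hspec⟩ := hanchor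
  obtain ⟨U, hU, c', hc', L₁, hpath⟩ := hC δ hδ c hc r L₀ P hspec
  exact ⟨U, hU, endpointTransfer_proof U δ c' P hU hδ hc' ⟨L₁, hpath⟩⟩

/-! ### D2 (σ-s seam: cut the coupling range at `s₀`) -/

/-- D2 piece LARGE: the floor on `[s₀, ∞)` (the RVB-dominated regime; informal item stmt-2783's
territory). -/
def LargeCouplingFloor (s₀ δ : ℝ) (P : (L : ℕ) → Op[L]) (U c' : ℝ) (L₁ : ℕ) : Prop :=
  ∀ (L : ℕ) [NeZero L], Even L → L₁ ≤ L → FloorOn (Set.Ici s₀) δ P U c' L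

/-- D2 piece SMALL: the floor on `(0, s₀]`, with admissibility and simplicity riding along. -/
def SmallCouplingFloor (s₀ δ : ℝ) (P : (L : ℕ) → Op[L]) (U c' : ℝ) (L₁ : ℕ) : Prop :=
  ∀ (L : ℕ) [NeZero L], Even L → L₁ ≤ L →
    (P L).IsHermitian ∧
    (∀ v, v ∈ szSector Nₑ[δ, L] 0 → P L *ᵥ v ∈ szSector Nₑ[δ, L] 0) ∧
    FloorOn (Set.Ioc 0 s₀) δ P U c' L ∧ SimpleGS δ U L

/-- D2 assembly: the two ranges recombine to the path block (case split on `s ≤ s₀`). [folklore] -/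
theorem d2_assembly {s₀ δ U c' : ℝ} {P : (L : ℕ) → Op[L]} {L₁ L₂ : ℕ}
    (hl : LargeCouplingFloor s₀ δ P U c' L₁) (hs : SmallCouplingFloor s₀ δ P U c' L₂) :
    PathBlock δ P U c' (max L₁ L₂) := by
  intro L _ hE hL
  obtain ⟨hPh, hPmap, hfl, hsimp⟩ := hs L hE (le_of_max_le_right hL)
  refine ⟨hPh, hPmap, fun s hs0 ψ hψ h1 => ?_, hsimp⟩
  rcases le_or_gt s s₀ with h | h
  · exact hfl s ⟨hs0, h⟩ ψ hψ h1
  · exact hl L hE (le_of_max_le_left hL) s (Set.mem_Ici.2 h.le) ψ hψ h1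

/-- D2's SMALL piece alone is the summit matrix at `(U, δ)` (accumulation lemma, `S = (0, s₀]`),
for every `s₀ > 0` however small. [folklore] -/
theorem d2_small_summitAt {s₀ δ U c' : ℝ} {P : (L : ℕ) → Op[L]} {L₂ : ℕ} (hs₀ : 0 < s₀)
    (hδ : -1 ≤ δ) (hc' : 0 < c') (hs : SmallCouplingFloor s₀ δ P U c' L₂) : SummitAt U δ :=
  summitAt_of_floorOn_of_simple (acc_Ioc hs₀) hδ hc' ⟨L₂, fun L _ hE hL => hs L hE hL⟩

/-! ### D3 (σ-simple seam: floor without simplicity / simplicity alone) -/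

/-- D3 piece 1: the path block WITHOUT the simplicity clause. -/
def PathOrderOnly (δ : ℝ) (P : (L : ℕ) → Op[L]) (U c' : ℝ) (L₁ : ℕ) : Prop :=
  ∀ (L : ℕ) [NeZero L], Even L → L₁ ≤ L →
    (P L).IsHermitian ∧
    (∀ v, v ∈ szSector Nₑ[δ, L] 0 → P L *ᵥ v ∈ szSector Nₑ[δ, L] 0) ∧
    FloorOn (Set.Ioi 0) δ P U c' L

/-- D3 piece 2: simplicity of the Hubbard sector ground state along large even sides. -/
def HubbardSimple (δ U : ℝ) (L₂ : ℕ) : Prop :=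
  ∀ (L : ℕ) [NeZero L], Even L → L₂ ≤ L → SimpleGS δ U L

/-- D3 assembly: thresholds merge (`max`). [folklore] -/
theorem d3_assembly {δ U c' : ℝ} {P : (L : ℕ) → Op[L]} {L₁ L₂ : ℕ} (h1 : PathOrderOnly δ P U c' L₁)
    (h2 : HubbardSimple δ U L₂) : PathBlock δ P U c' (max L₁ L₂) := by
  intro L _ hE hL
  obtain ⟨hPh, hPmap, hfl⟩ := h1 L hE (le_of_max_le_left hL)
  exact ⟨hPh, hPmap, fun s hs => hfl s hs, h2 L hE (le_of_max_le_right hL)⟩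

/-- D3's piece 1 alone is the ∃-ground-state d-wave order of the PURE model at `(U, δ)` along even
sides — the summit with `∀ψ` weakened to `∃ψ` (accumulation lemma, `S = (0, ∞)`). [folklore] -/
theorem d3_orderOnly_existsGSOrder {δ U c' : ℝ} {P : (L : ℕ) → Op[L]} {L₁ : ℕ} (hδ : -1 ≤ δ)
    (h1 : PathOrderOnly δ P U c' L₁) : ExistsGSOrderAt U δ c' L₁ := by
  intro L _ hE hL
  obtain ⟨hPh, hPmap, hfl⟩ := h1 L hE hL
  exact exists_groundState_floor_of_floorOn acc_Ioi hδ L hPh hPmap hfl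

/-- … and with piece 2 it is the summit matrix. [folklore] -/
theorem d3_pieces_summitAt {δ U c' : ℝ} {P : (L : ℕ) → Op[L]} {L₁ L₂ : ℕ} (hδ : -1 ≤ δ)
    (hc' : 0 < c') (h1 : PathOrderOnly δ P U c' L₁) (h2 : HubbardSimple δ U L₂) : SummitAt U δ :=
  summitAt_of_floorOn_of_simple acc_Ioi hδ hc' ⟨max L₁ L₂, fun L _ hE hL =>
    ⟨(h1 L hE (le_of_max_le_left hL)).1, (h1 L hE (le_of_max_le_left hL)).2.1,
      (h1 L hE (le_of_max_le_left hL)).2.2, h2 L hE (le_of_max_le_right hL)⟩⟩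

/-! ### D4 (σ-mech seam: a TRANSPORT LAW carries the floor from `[s₀,∞)` down to `0⁺`) -/

/-- D4 piece 2: the transport law — for every admissible anchored datum, a d-wave floor on `[s₀, ∞)`
propagates (with some smaller constant) to all `s > 0`. No instance of such a law is known for any
interacting lattice model; see the census for why it is summit-or-harder and why its natural
hypotheses are refuted in kind (`AposterioriCapRgKlsOrderOpenness_refuted`, twist ceiling). -/
def TransportLaw : Prop :=
  ∀ (δ c : ℝ) (r L₀ : ℕ) (P : (L : ℕ) → Op[L]) (U c' s₀ : ℝ) (L₁ : ℕ),
    δ ∈ Set.Ioo (0 : ℝ) (1 / 2) → 0 < c → AnchorSpec δ c r L₀ P → 0 < U → 0 < c' → 0 < s₀ →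
    LargeCouplingFloor s₀ δ P U c' L₁ →
      ∃ c'' : ℝ, 0 < c'' ∧ ∃ L₂ : ℕ, ∀ (L : ℕ) [NeZero L], Even L → L₂ ≤ L →
        FloorOn (Set.Ioi 0) δ P U c'' L

/-- D4 piece 1: anchor ∧ large-coupling floor ∧ admissibility ∧ simplicity about ONE datum (the
RVB-side bet; not the summit: nothing is claimed for `s < s₀`). -/
def AnchoredLargeCoupling : Prop :=
  ∃ δ ∈ Set.Ioo (0 : ℝ) (1 / 2), ∃ c : ℝ, 0 < c ∧ ∃ r L₀ : ℕ, ∃ P : (L : ℕ) → Op[L],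
    AnchorSpec δ c r L₀ P ∧ ∃ U : ℝ, 0 < U ∧ ∃ c' s₀ : ℝ, 0 < c' ∧ 0 < s₀ ∧ ∃ L₁ : ℕ,
      LargeCouplingFloor s₀ δ P U c' L₁ ∧ HubbardSimple δ U L₁ ∧
      ∀ (L : ℕ) [NeZero L], Even L → L₁ ≤ L → (P L).IsHermitian ∧
        ∀ v, v ∈ szSector Nₑ[δ, L] 0 → P L *ᵥ v ∈ szSector Nₑ[δ, L] 0

/-- D4 assembly (`AnchoredLargeCoupling ∧ TransportLaw → PathLRO`): instantiate the law at the datum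
and merge thresholds — modus ponens plus bookkeeping. [folklore] -/
theorem d4_assembly (h : AnchoredLargeCoupling) (hT : TransportLaw) : PathLRO := by
  obtain ⟨δ, hδ, c, hc, r, L₀, P, hA, U, hU, c', s₀, hc', hs₀, L₁, hlarge, hsimp, hadm⟩ := h
  obtain ⟨c'', hc'', L₂, hfloor⟩ := hT δ c r L₀ P U c' s₀ L₁ hδ hc hA hU hc' hs₀ hlarge
  refine ⟨δ, hδ, c, hc, r, L₀, P, hA, U, hU, c'', hc'', max L₁ L₂, fun L _ hE hL => ?_⟩
  obtain ⟨hPh, hPmap⟩ := hadm L hE (le_of_max_le_left hL)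
  exact ⟨hPh, hPmap, fun s hs => hfloor L hE (le_of_max_le_right hL) s hs,
    hsimp L hE (le_of_max_le_left hL)⟩

end Summit.HubbardSuperconductivity.HubbardSuperconductivity.Cruxes.PathLRO.StrategistR1
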